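import Summits.CriticalPhenomena.PercolationContinuityZ3.Theorems.PercNearOneGluingNoHeavyLowerTailSahiE3DimerLayers
import Summits.CriticalPhenomena.PercolationContinuityZ3.Theorems.PercNearOneGluingNoHeavyLowerTailSahiE3DimerPacking
import Summits.CriticalPhenomena.PercolationContinuityZ3.Theorems.PercNearOneGluingNoHeavyLowerTailSahiE3DimerMass
import Mathlib.Tactic.Linarith
import Mathlib.Tactic.Ring
import Mathlib.Tactic.Positivity
import HarnessLib
import HarnessLib.Audit

/-!
# `NoHeavyLowerTail` (crux stmt-CriticalPhenomena-4575), Sahi programme P4: the dimer OR-step `(x ∧ y) ∨ G`, file 4 — the flow certificate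

Support file (cell `prim-l12`, seat P4, generation 14; `--supports stmt-CriticalPhenomena-4575`).  No named facts, no sorries; std axioms; def-free.
THEOREM `cert_dimer_or_step`: from an exact flow certificate of an up-set `G ⊆ Q` (hypotheses of `…SahiE3LroOrStep.cert_or_step`) and weights
`wtt, wtf, wft, wff ≥ 0` with `wtf·wft ≤ wtt·wff` (e.g. the product weights of two independent bits), the slot `U = {x | x.1 = (true,true) ∨ x.2 ∈ G}`
("`(x ∧ y) ∨ G`") of `(Bool × Bool) × Q` with the layered weight `ν(b,s) = w_b ν'(s)` carries an exact flow certificate (the flat composite).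
The pair inequality is the half-page argument of HOME prim-l12-p4/FROM-prim-l12-p4-gen14-DIMER-REDUCTION.md §1–3 (identity (ID), the packing
inequalities `packing_cross`/`packing_diamond` mixed with weights `Z'/(Z'+N'_D)`, `N'_D/(Z'+N'_D)`, eleven inner pair inequalities, the cap on the two
crossing cells, `mod_sum_ge_cross`, `dimer_Td_bound`, `need_sdiff_le`), assembled as one polynomial identity (HOME code/gen14/cert/symcert.py) and
closed by `linarith`.  Consequence (next file): Kahn's Conjecture 5 for every first slot `⋁ᵢ (xᵢ ∧ yᵢ) ∨ ⋯` (DNF of width two).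
-/

namespace Summit.CriticalPhenomena.PercolationContinuityZ3.Theorems.SahiE3DimerOrStep

open Finset SahiE3DimerLayers SahiE3DimerPacking SahiE3DimerMass
open scoped BigOperators

variable {Q : Type*} [DecidableEq Q]


/-- `ν(A) = ν(A ∩ B) + ν(A ∖ B)`. [folklore] -/
theorem sum_eq_inter_add_sdiff (ν : Q → ℝ) (A B : Finset Q) :
    ∑ t ∈ A, ν t = ∑ t ∈ A ∩ B, ν t + ∑ t ∈ A \ B, ν t := by
  rw [← Finset.sum_filter_add_sum_filter_not A (fun t => t ∈ B), Finset.filter_mem_eq_inter]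
  congr 1
  exact Finset.sum_congr (by ext t; simp [Finset.mem_sdiff]) fun _ _ => rfl

/-- `ν(A ∩ G) = ν(A ∩ B ∩ G) + ν((A ∖ B) ∩ G)`. [folklore] -/
theorem sum_inter_eq_inter_add_sdiff (ν : Q → ℝ) (A B G : Finset Q) :
    ∑ t ∈ A ∩ G, ν t = ∑ t ∈ (A ∩ B) ∩ G, ν t + ∑ t ∈ (A \ B) ∩ G, ν t := by
  rw [sum_eq_inter_add_sdiff ν (A ∩ G) B]
  congr 1
  · exact Finset.sum_congr (by ext t; simp only [Finset.mem_inter]; tauto) fun _ _ => rfl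
  · exact Finset.sum_congr (by ext t; simp only [Finset.mem_inter, Finset.mem_sdiff]; tauto) fun _ _ => rfl

/-- `ν(A ∪ B) = ν(A ∩ B) + ν(A ∖ B) + ν(B ∖ A)`. [folklore] -/
theorem sum_union_eq_three (ν : Q → ℝ) (A B : Finset Q) :
    ∑ t ∈ A ∪ B, ν t = ∑ t ∈ A ∩ B, ν t + ∑ t ∈ A \ B, ν t + ∑ t ∈ B \ A, ν t := by
  have h1 := Finset.sum_union_inter (s₁ := A) (s₂ := B) (f := ν)
  have h2 := sum_eq_inter_add_sdiff ν A B
  have h3 := sum_eq_inter_add_sdiff ν B A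
  rw [Finset.inter_comm B A] at h3
  linarith

/-- `ν((A ∪ B) ∩ G) = ν(A ∩ B ∩ G) + ν((A ∖ B) ∩ G) + ν((B ∖ A) ∩ G)`. [folklore] -/
theorem sum_union_inter_eq_three (ν : Q → ℝ) (A B G : Finset Q) :
    ∑ t ∈ (A ∪ B) ∩ G, ν t = ∑ t ∈ (A ∩ B) ∩ G, ν t + ∑ t ∈ (A \ B) ∩ G, ν t + ∑ t ∈ (B \ A) ∩ G, ν t := by
  rw [Finset.union_inter_distrib_right, sum_union_eq_three ν (A ∩ G) (B ∩ G)]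
  have e1 : (A ∩ G) ∩ (B ∩ G) = (A ∩ B) ∩ G := by ext t; simp only [Finset.mem_inter]; tauto
  have e2 : (A ∩ G) \ (B ∩ G) = (A \ B) ∩ G := by ext t; simp only [Finset.mem_inter, Finset.mem_sdiff]; tauto
  have e3 : (B ∩ G) \ (A ∩ G) = (B \ A) ∩ G := by ext t; simp only [Finset.mem_inter, Finset.mem_sdiff]; tauto
  rw [e1, e2, e3]

variable [Fintype Q] [PartialOrder Q]

set_option maxHeartbeats 4000000 in
/-- **Dimer OR-step of the flow certificate** (`(x ∧ y) ∨ G`): see the module docstring. [this work] -/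
theorem cert_dimer_or_step {ν' : Q → ℝ} (hν' : ∀ t, 0 ≤ ν' t)
    (hH : ∀ S S' : Finset Q, IsUpperSet (S : Set Q) → IsUpperSet (S' : Set Q) →
      (∑ t ∈ S, ν' t) * (∑ t ∈ S', ν' t) ≤ (∑ t, ν' t) * ∑ t ∈ S ∩ S', ν' t)
    (G : Finset Q) (hG : IsUpperSet (G : Set Q)) (R' : Q → ℝ) (Fl' : Q → Q → ℝ)
    (hR'0 : ∀ t ∈ G, 0 ≤ R' t) (hF'0 : ∀ t s, 0 ≤ Fl' t s) (hF'le : ∀ t s, Fl' t s ≠ 0 → s ≤ t)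
    (hcap' : ∀ t ∈ G, R' t + ∑ s ∈ Gᶜ, Fl' t s ≤ (∑ r, ν' r) * ((∑ r, ν' r) + ∑ r ∈ Gᶜ, ν' r) * ν' t)
    (hK' : ∀ s ∈ Gᶜ, ∑ t ∈ G, Fl' t s = (∑ r, ν' r) * (∑ r ∈ G, ν' r) * ν' s)
    (hpair' : ∀ S S' : Finset Q, IsUpperSet (S : Set Q) → IsUpperSet (S' : Set Q) →
      (∑ r, ν' r) * ((∑ t ∈ S, ν' t) * (∑ t ∈ S' ∩ G, ν' t) + (∑ t ∈ S', ν' t) * (∑ t ∈ S ∩ G, ν' t))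
          - (∑ r ∈ G, ν' r) * (∑ t ∈ S, ν' t) * (∑ t ∈ S', ν' t) ≤ ∑ t ∈ (S ∩ S') ∩ G, R' t)
    {wtt wtf wft wff : ℝ} (h0tt : 0 ≤ wtt) (h0tf : 0 ≤ wtf) (h0ft : 0 ≤ wft) (h0ff : 0 ≤ wff)
    (hpa : wtf * wft ≤ wtt * wff)
    (ν : (Bool × Bool) × Q → ℝ) (htt : ∀ s, ν ((true, true), s) = wtt * ν' s) (htf : ∀ s, ν ((true, false), s) = wtf * ν' s)
    (hft : ∀ s, ν ((false, true), s) = wft * ν' s) (hff : ∀ s, ν ((false, false), s) = wff * ν' s)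
    (U : Finset ((Bool × Bool) × Q)) (hU : ∀ x, x ∈ U ↔ (x.1 = (true, true) ∨ x.2 ∈ G)) :
    ∃ (R : (Bool × Bool) × Q → ℝ) (Fl : ((Bool × Bool) × Q) → ((Bool × Bool) × Q) → ℝ),
      (∀ t ∈ U, 0 ≤ R t) ∧ (∀ t s, 0 ≤ Fl t s) ∧ (∀ t s, Fl t s ≠ 0 → s ≤ t) ∧
      (∀ t ∈ U, R t + ∑ s ∈ Uᶜ, Fl t s ≤ (∑ r, ν r) * ((∑ r, ν r) + ∑ r ∈ Uᶜ, ν r) * ν t) ∧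
      (∀ s ∈ Uᶜ, ∑ t ∈ U, Fl t s = (∑ r, ν r) * (∑ r ∈ U, ν r) * ν s) ∧
      (∀ S S' : Finset ((Bool × Bool) × Q), IsUpperSet (S : Set ((Bool × Bool) × Q)) →
        IsUpperSet (S' : Set ((Bool × Bool) × Q)) →
        (∑ r, ν r) * ((∑ t ∈ S, ν t) * (∑ t ∈ S' ∩ U, ν t) + (∑ t ∈ S', ν t) * (∑ t ∈ S ∩ U, ν t))
            - (∑ r ∈ U, ν r) * (∑ t ∈ S, ν t) * (∑ t ∈ S', ν t) ≤ ∑ t ∈ (S ∩ S') ∩ U, R t) := by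
  -- sections of `U`, `Uᶜ`
  obtain ⟨-, -, -, -, LuTT, LuTF, LuFT, LuFF, LcTT, LcTF, LcFT, LcFF⟩ := sec_dimerSlot G U hU U
  obtain ⟨Z', hZ'⟩ : ∃ x : ℝ, ∑ t, ν' t = x := ⟨_, rfl⟩
  obtain ⟨NG, hNG⟩ : ∃ x : ℝ, ∑ t ∈ G, ν' t = x := ⟨_, rfl⟩
  obtain ⟨ND, hND⟩ : ∃ x : ℝ, ∑ t ∈ Gᶜ, ν' t = x := ⟨_, rfl⟩
  have hsplit : Z' = NG + ND := by rw [← hZ', ← hNG, ← hND]; exact (Finset.sum_add_sum_compl G ν').symm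
  have hZ'0 : 0 ≤ Z' := hZ' ▸ Finset.sum_nonneg fun t _ => hν' t
  have hNG0 : 0 ≤ NG := hNG ▸ Finset.sum_nonneg fun t _ => hν' t
  have hND0 : 0 ≤ ND := hND ▸ Finset.sum_nonneg fun t _ => hν' t
  rw [hZ'] at hH; rw [hZ', hND] at hcap'; rw [hZ', hNG] at hK' hpair'
  -- the fibre weight as a function
  set wB : Bool × Bool → ℝ := fun b => if b.1 = true then (if b.2 = true then wtt else wtf) else (if b.2 = true then wft else wff) with hwB
  have hwB0 : ∀ b, 0 ≤ wB b := by rintro ⟨c, d⟩; cases c <;> cases d <;> simp [hwB, h0tt, h0tf, h0ft, h0ff]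
  have hνw : ∀ b s, ν (b, s) = wB b * ν' s := by rintro ⟨c, d⟩ s; cases c <;> cases d <;> simp [hwB, htt, htf, hft, hff]
  obtain ⟨qb, hqb⟩ : ∃ q : ℝ, q = wtf + wft + wff := ⟨_, rfl⟩
  obtain ⟨W, hWq⟩ : ∃ x : ℝ, x = wtt + qb := ⟨_, rfl⟩
  have hqb0 : 0 ≤ qb := by rw [hqb]; positivity
  have hW0 : 0 ≤ W := by rw [hWq]; positivity
  have hW : W = wtt + wtf + wft + wff := by rw [hWq, hqb]; ring
  -- masses of `univ`, `U`, `Uᶜ`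
  have lay := fun X => sum_weight_fibres (ν := ν) htt htf hft hff X
  have eZ : ∑ x, ν x = W * Z' := by rw [sum_weight_univ htt htf hft hff, hZ', hW]
  have eU : ∑ x ∈ U, ν x = wtt * Z' + qb * NG := by rw [lay U, LuTT, LuTF, LuFT, LuFF, hZ', hNG, hqb]; ring
  have eUc : ∑ x ∈ Uᶜ, ν x = qb * ND := by rw [lay Uᶜ, LcTT, LcTF, LcFT, LcFF, Finset.sum_empty, hND, hqb]; ring
  have memU : ∀ (b : Bool × Bool) (s : Q), ((b, s) ∈ U) ↔ (b = (true, true) ∨ s ∈ G) := fun b s => hU (b, s)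
  -- the certificate
  refine ⟨fun x => if x.1 = (true, true) then
      wtt * ν' x.2 * (W * Z') * (W * Z' + qb * ND - (if x.2 ∈ G then 0 else qb * Z'))
      else W * wB x.1 * (wtt * Z' ^ 2 * ν' x.2 + qb * R' x.2),
    fun x y => if x.1 = (true, true) then (if x.2 = y.2 then W * Z' ^ 2 * wtt * wB y.1 * ν' y.2 else 0)
      else (if x.1 = y.1 then W * qb * wB y.1 * Fl' x.2 y.2 else 0), ?_, ?_, ?_, ?_, ?_, ?_⟩
  · -- (R0)
    rintro ⟨b, t⟩ hx
    have hνt0 := hν' t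
    by_cases hb : b = (true, true)
    · simp only [hb, ↓reduceIte]
      have h1 : 0 ≤ W * Z' + qb * ND - (if t ∈ G then 0 else qb * Z') := by
        split_ifs <;> nlinarith [mul_nonneg h0tt hZ'0, mul_nonneg hqb0 hND0, mul_nonneg hqb0 hZ'0]
      exact mul_nonneg (by positivity) h1
    · have ht : t ∈ G := by have := (memU b t).1 hx; tauto
      have := hR'0 t ht; have := hwB0 b
      simp only [hb, ↓reduceIte]; positivity
  · -- (F0)
    rintro ⟨b, t⟩ ⟨b', s⟩
    have := hF'0 t s; have := hν' s; have := hwB0 b'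
    dsimp only
    split_ifs <;> positivity
  · -- (F≤)
    rintro ⟨b, t⟩ ⟨b', s⟩ h
    dsimp only at h
    by_cases hb : b = (true, true)
    · subst hb
      simp only [↓reduceIte, ne_eq, ite_eq_right_iff, Classical.not_imp] at h
      obtain ⟨hts, -⟩ := h
      subst hts
      refine ⟨?_, le_rfl⟩
      obtain ⟨c, d⟩ := b'
      exact ⟨Bool.le_true c, Bool.le_true d⟩
    · simp only [hb, ↓reduceIte, ne_eq, ite_eq_right_iff, Classical.not_imp] at h
      obtain ⟨hbb, hne⟩ := h
      subst hbb
      exact ⟨le_rfl, hF'le t s (by intro h0; exact hne (by rw [h0, mul_zero]))⟩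
  · -- (cap)
    rintro ⟨b, t⟩ hx
    have hνt0 := hν' t
    rw [sum_fibres Uᶜ, LcTT, LcTF, LcFT, LcFF, Finset.sum_empty, zero_add, eZ, eUc, hνw]
    by_cases hb : b = (true, true)
    · subst hb
      simp only [↓reduceIte]
      rw [Finset.sum_ite_eq Gᶜ t, Finset.sum_ite_eq Gᶜ t, Finset.sum_ite_eq Gᶜ t]
      by_cases htG : t ∈ G
      · have : t ∉ Gᶜ := by simpa using htG
        simp only [htG, this, ↓reduceIte, hwB, add_zero]; rw [hWq, hqb]; nlinarith [hνt0]
      · have : t ∈ Gᶜ := by simpa using htG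
        simp only [htG, this, ↓reduceIte, hwB, Bool.false_eq_true]; rw [hWq, hqb]; nlinarith [hνt0]
    · have ht : t ∈ G := by have := (memU b t).1 hx; tauto
      have hc := hcap' t ht
      have h1a := mul_le_mul_of_nonneg_left hc (by positivity : 0 ≤ W * qb * wtf)
      have h1b := mul_le_mul_of_nonneg_left hc (by positivity : 0 ≤ W * qb * wft)
      have h1c := mul_le_mul_of_nonneg_left hc (by positivity : 0 ≤ W * qb * wff)
      rw [hWq] at h1a h1b h1c
      obtain ⟨c, d⟩ := b
      cases c <;> cases d <;>
        simp only [Prod.mk.injEq, Bool.true_eq_false, Bool.false_eq_true, and_false, and_true, and_self,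
          ↓reduceIte, not_true_eq_false, Finset.sum_const_zero, add_zero, hwB] at hb ⊢ <;>
        first | exact absurd trivial hb | (rw [← Finset.mul_sum, hWq]; linarith [h1a, h1b, h1c])
  · -- (K) with equality
    rintro ⟨b, s⟩ hs
    obtain ⟨hb, hsG⟩ : ¬ (b = (true, true)) ∧ s ∉ G := by simpa [memU] using hs
    have hsGc : s ∈ Gᶜ := by simpa using hsG
    rw [sum_fibres U, LuTT, LuTF, LuFT, LuFF, eZ, eU, hνw]
    obtain ⟨c, d⟩ := b
    cases c <;> cases d <;>
      simp only [Prod.mk.injEq, Bool.true_eq_false, Bool.false_eq_true, and_false, and_true, and_self,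
        ↓reduceIte, not_true_eq_false, Finset.sum_const_zero, add_zero, hwB] at hb ⊢ <;>
      first | exact absurd trivial hb | (rw [Finset.sum_ite_eq' univ s, if_pos (Finset.mem_univ s), ← Finset.mul_sum, hK' s hsGc]; ring)
  · -- (pair)
    intro S S' hS hS'
    set St := univ.filter (fun s => ((true, true), s) ∈ S) with hSt
    set Sa := univ.filter (fun s => ((true, false), s) ∈ S) with hSa
    set Sb := univ.filter (fun s => ((false, true), s) ∈ S) with hSb
    set So := univ.filter (fun s => ((false, false), s) ∈ S) with hSo
    set Tt := univ.filter (fun s => ((true, true), s) ∈ S') with hTt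
    set Ta := univ.filter (fun s => ((true, false), s) ∈ S') with hTa
    set Tb := univ.filter (fun s => ((false, true), s) ∈ S') with hTb
    set To := univ.filter (fun s => ((false, false), s) ∈ S') with hTo
    have uSt : IsUpperSet (St : Set Q) := isUpperSet_sec hS (true, true)
    have uSa : IsUpperSet (Sa : Set Q) := isUpperSet_sec hS (true, false)
    have uSb : IsUpperSet (Sb : Set Q) := isUpperSet_sec hS (false, true)
    have uSo : IsUpperSet (So : Set Q) := isUpperSet_sec hS (false, false)
    have uTt : IsUpperSet (Tt : Set Q) := isUpperSet_sec hS' (true, true)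
    have uTa : IsUpperSet (Ta : Set Q) := isUpperSet_sec hS' (true, false)
    have uTb : IsUpperSet (Tb : Set Q) := isUpperSet_sec hS' (false, true)
    have uTo : IsUpperSet (To : Set Q) := isUpperSet_sec hS' (false, false)
    obtain ⟨hSoa, hSob, hSat, hSbt, -⟩ := sec_nested hS
    obtain ⟨hToa, hTob, hTat, hTbt, -⟩ := sec_nested hS'
    have hG' : IsUpperSet (G : Set Q) := hG
    have uI : ∀ A B : Finset Q, IsUpperSet (A : Set Q) → IsUpperSet (B : Set Q) → IsUpperSet ((A ∩ B : Finset Q) : Set Q) := fun A B hA hB => by rw [Finset.coe_inter]; exact hA.inter hB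
    have uUn : ∀ A B : Finset Q, IsUpperSet (A : Set Q) → IsUpperSet (B : Set Q) → IsUpperSet ((A ∪ B : Finset Q) : Set Q) := fun A B hA hB => by rw [Finset.coe_union]; exact hA.union hB
    -- masses in section form
    have eS : ∑ x ∈ S, ν x = wtt * ∑ t ∈ St, ν' t + wtf * ∑ t ∈ Sa, ν' t + wft * ∑ t ∈ Sb, ν' t + wff * ∑ t ∈ So, ν' t := lay S
    have eS' : ∑ x ∈ S', ν x = wtt * ∑ t ∈ Tt, ν' t + wtf * ∑ t ∈ Ta, ν' t + wft * ∑ t ∈ Tb, ν' t + wff * ∑ t ∈ To, ν' t := lay S'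
    obtain ⟨sSt, sSa, sSb, sSo, -⟩ := sec_dimerSlot G U hU S
    obtain ⟨sTt, sTa, sTb, sTo, -⟩ := sec_dimerSlot G U hU S'
    have eSU : ∑ x ∈ S ∩ U, ν x = wtt * ∑ t ∈ St, ν' t + wtf * ∑ t ∈ Sa ∩ G, ν' t + wft * ∑ t ∈ Sb ∩ G, ν' t + wff * ∑ t ∈ So ∩ G, ν' t := by
      rw [lay (S ∩ U), sSt, sSa, sSb, sSo]
    have eS'U : ∑ x ∈ S' ∩ U, ν x = wtt * ∑ t ∈ Tt, ν' t + wtf * ∑ t ∈ Ta ∩ G, ν' t + wft * ∑ t ∈ Tb ∩ G, ν' t + wff * ∑ t ∈ To ∩ G, ν' t := by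
      rw [lay (S' ∩ U), sTt, sTa, sTb, sTo]
    -- the retained mass on `S ∩ S' ∩ U`
    obtain ⟨iTT, iTF, iFT, iFF, -⟩ := sec_dimerSlot G U hU (S ∩ S')
    have eR : ∑ x ∈ (S ∩ S') ∩ U, (fun x : (Bool × Bool) × Q => if x.1 = (true, true) then
          wtt * ν' x.2 * (W * Z') * (W * Z' + qb * ND - (if x.2 ∈ G then 0 else qb * Z'))
          else W * wB x.1 * (wtt * Z' ^ 2 * ν' x.2 + qb * R' x.2)) x =
        wtt * (W * Z') * (W * Z' + qb * ND) * ∑ t ∈ St ∩ Tt, ν' t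
          - wtt * (W * Z') * (qb * Z') * ∑ t ∈ St ∩ Tt, (if t ∈ G then 0 else ν' t)
          + (W * wtf * (wtt * Z' ^ 2) * ∑ t ∈ (Sa ∩ Ta) ∩ G, ν' t + W * wtf * qb * ∑ t ∈ (Sa ∩ Ta) ∩ G, R' t)
          + (W * wft * (wtt * Z' ^ 2) * ∑ t ∈ (Sb ∩ Tb) ∩ G, ν' t + W * wft * qb * ∑ t ∈ (Sb ∩ Tb) ∩ G, R' t)
          + (W * wff * (wtt * Z' ^ 2) * ∑ t ∈ (So ∩ To) ∩ G, ν' t + W * wff * qb * ∑ t ∈ (So ∩ To) ∩ G, R' t) := by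
      rw [sum_fibres ((S ∩ S') ∩ U), iTT, iTF, iFT, iFF, sec_inter, sec_inter, sec_inter, sec_inter]
      simp only [↓reduceIte, Prod.mk.injEq, Bool.false_eq_true, and_false, and_true, and_self, hwB]
      rw [← hSt, ← hTt, ← hSa, ← hTa, ← hSb, ← hTb, ← hSo, ← hTo]
      have e1 : ∑ t ∈ St ∩ Tt, wtt * ν' t * (W * Z') * (W * Z' + qb * ND - (if t ∈ G then 0 else qb * Z')) =
          wtt * (W * Z') * (W * Z' + qb * ND) * ∑ t ∈ St ∩ Tt, ν' t
            - wtt * (W * Z') * (qb * Z') * ∑ t ∈ St ∩ Tt, (if t ∈ G then 0 else ν' t) := by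
        rw [Finset.mul_sum, Finset.mul_sum, ← Finset.sum_sub_distrib]
        exact Finset.sum_congr rfl fun t _ => by split_ifs <;> ring
      have e2 : ∀ (w : ℝ) (X : Finset Q), ∑ t ∈ X, W * w * (wtt * Z' ^ 2 * ν' t + qb * R' t) =
          W * w * (wtt * Z' ^ 2) * ∑ t ∈ X, ν' t + W * w * qb * ∑ t ∈ X, R' t := by
        intro w X
        rw [Finset.mul_sum, Finset.mul_sum, ← Finset.sum_add_distrib]
        exact Finset.sum_congr rfl fun t _ => by ring
      rw [e1, e2, e2, e2]
    -- the `G`-split of the top cell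
    have hI : ∑ t ∈ St ∩ Tt, ν' t = ∑ t ∈ (St ∩ Tt) ∩ G, ν' t + ∑ t ∈ St ∩ Tt, (if t ∈ G then 0 else ν' t) := by
      rw [← Finset.sum_filter_add_sum_filter_not (St ∩ Tt) (fun t => t ∈ G), Finset.sum_ite, Finset.sum_const_zero,
        zero_add, Finset.filter_mem_eq_inter]
    have hA : (∑ t ∈ St ∩ Tt, if t ∈ G then (0:ℝ) else ν' t) = ∑ t ∈ St ∩ Tt, ν' t - ∑ t ∈ (St ∩ Tt) ∩ G, ν' t := by
      linarith [hI]
    rw [eZ, eU, eS, eS', eSU, eS'U, eR, hA]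
    -- === the facts ===
    -- Harris on `Q`
    have Htt := hH St Tt uSt uTt
    have Hta := hH St (Ta ∩ G) uSt (uI Ta G uTa hG')
    have Htb := hH St (Tb ∩ G) uSt (uI Tb G uTb hG')
    have Hto := hH St (To ∩ G) uSt (uI To G uTo hG')
    have Hat := hH Tt (Sa ∩ G) uTt (uI Sa G uSa hG')
    have Hbt := hH Tt (Sb ∩ G) uTt (uI Sb G uSb hG')
    have Hot := hH Tt (So ∩ G) uTt (uI So G uSo hG')
    rw [← Finset.inter_assoc] at Hta Htb Hto
    have cA : ∀ A : Finset Q, Tt ∩ (A ∩ G) = (A ∩ Tt) ∩ G := fun A => by ext t; simp only [Finset.mem_inter]; tauto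
    rw [cA] at Hat Hbt Hot
    -- modularity cells
    have hν'G : ∀ t ∈ G, 0 ≤ ν' t := fun t _ => hν' t
    have Ma := mod_sum_nonneg ν' G St Sa Tt Ta hν'G hSat hTat
    have Mb := mod_sum_nonneg ν' G St Sb Tt Tb hν'G hSbt hTbt
    have Mo := mod_sum_ge_cross ν' G So Sa Sb St To Ta Tb Tt hν'G hSoa hSob hSat hSbt hToa hTob hTat hTbt
    -- packing
    have PkC := packing_cross R' G So Sa Sb To Ta Tb hR'0 hSoa hSob hToa hTob h0ff h0tf h0ft
    have PkD := packing_diamond R' G So Sa Sb To Ta Tb hR'0 hSoa hSob hToa hTob h0ff h0tf h0ft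
    -- inner pair inequalities
    have Paa := hpair' Sa Ta uSa uTa
    have Pab := hpair' Sa Tb uSa uTb
    have Pao := hpair' Sa To uSa uTo
    have Pba := hpair' Sb Ta uSb uTa
    have Pbb := hpair' Sb Tb uSb uTb
    have Pbo := hpair' Sb To uSb uTo
    have Poa := hpair' So Ta uSo uTa
    have Pob := hpair' So Tb uSo uTb
    have Poo := hpair' So To uSo uTo
    have Pd1 := hpair' (Sa ∩ Sb) (Ta ∪ Tb) (uI Sa Sb uSa uSb) (uUn Ta Tb uTa uTb)
    have Pd2 := hpair' (Sa ∪ Sb) (Ta ∩ Tb) (uUn Sa Sb uSa uSb) (uI Ta Tb uTa uTb)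
    -- cap on the crossing cells
    have capX : ∀ X : Finset Q, ∑ t ∈ X ∩ G, R' t ≤ Z' * (Z' + ND) * ∑ t ∈ X ∩ G, ν' t := by
      intro X
      rw [Finset.mul_sum]
      refine Finset.sum_le_sum fun t ht => ?_
      have htG : t ∈ G := (Finset.mem_inter.1 ht).2
      have h1 := hcap' t htG
      have h2 : 0 ≤ ∑ s ∈ Gᶜ, Fl' t s := Finset.sum_nonneg fun s _ => hF'0 t s
      linarith
    have Cx1 := capX ((Sa \ Sb) ∩ (Tb \ Ta))
    have Cx2 := capX ((Sb \ Sa) ∩ (Ta \ Tb))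
    -- the product term
    have x1le := sdiff_sum_le_sub ν' hν' Sa Sb St hSat hSbt
    have x2le := sdiff_sum_le_sub ν' hν' Sb Sa St hSbt hSat
    have x12le := two_sdiff_sum_le_sub ν' hν' So Sa Sb St hSoa hSob hSat hSbt
    have y1le := sdiff_sum_le_sub ν' hν' Tb Ta Tt hTbt hTat
    have y2le := sdiff_sum_le_sub ν' hν' Ta Tb Tt hTat hTbt
    have y12le := two_sdiff_sum_le_sub ν' hν' To Ta Tb Tt hToa hTob hTat hTbt
    have hx1 : 0 ≤ ∑ t ∈ Sa \ Sb, ν' t := Finset.sum_nonneg fun t _ => hν' t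
    have hx2 : 0 ≤ ∑ t ∈ Sb \ Sa, ν' t := Finset.sum_nonneg fun t _ => hν' t
    have hy1 : 0 ≤ ∑ t ∈ Tb \ Ta, ν' t := Finset.sum_nonneg fun t _ => hν' t
    have hy2 : 0 ≤ ∑ t ∈ Ta \ Tb, ν' t := Finset.sum_nonneg fun t _ => hν' t
    have hL : wff * (∑ t ∈ Sa \ Sb, ν' t + ∑ t ∈ Sb \ Sa, ν' t) + wft * ∑ t ∈ Sa \ Sb, ν' t + wtf * ∑ t ∈ Sb \ Sa, ν' t
        ≤ qb * ∑ t ∈ St, ν' t - (wtf * ∑ t ∈ Sa, ν' t + wft * ∑ t ∈ Sb, ν' t + wff * ∑ t ∈ So, ν' t) := by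
      rw [hqb]; linarith [mul_le_mul_of_nonneg_left x12le h0ff, mul_le_mul_of_nonneg_left x1le h0ft, mul_le_mul_of_nonneg_left x2le h0tf]
    have hL' : wff * (∑ t ∈ Tb \ Ta, ν' t + ∑ t ∈ Ta \ Tb, ν' t) + wtf * ∑ t ∈ Tb \ Ta, ν' t + wft * ∑ t ∈ Ta \ Tb, ν' t
        ≤ qb * ∑ t ∈ Tt, ν' t - (wtf * ∑ t ∈ Ta, ν' t + wft * ∑ t ∈ Tb, ν' t + wff * ∑ t ∈ To, ν' t) := by
      rw [hqb]; linarith [mul_le_mul_of_nonneg_left y12le h0ff, mul_le_mul_of_nonneg_left y1le h0tf, mul_le_mul_of_nonneg_left y2le h0ft]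
    have Td := dimer_Td_bound (νo := wff) (νa := wtf) (νb := wft) (x₁ := ∑ t ∈ Sa \ Sb, ν' t) (x₂ := ∑ t ∈ Sb \ Sa, ν' t)
      (y₁ := ∑ t ∈ Tb \ Ta, ν' t) (y₂ := ∑ t ∈ Ta \ Tb, ν' t)
      (L := qb * ∑ t ∈ St, ν' t - (wtf * ∑ t ∈ Sa, ν' t + wft * ∑ t ∈ Sb, ν' t + wff * ∑ t ∈ So, ν' t))
      (L' := qb * ∑ t ∈ Tt, ν' t - (wtf * ∑ t ∈ Ta, ν' t + wft * ∑ t ∈ Tb, ν' t + wff * ∑ t ∈ To, ν' t))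
      h0ff h0tf h0ft hx1 hx2 hy1 hy2 hL hL'
    have x1G : ∑ t ∈ (Sa \ Sb) ∩ G, ν' t ≤ ∑ t ∈ Sa \ Sb, ν' t := Finset.sum_le_sum_of_subset_of_nonneg Finset.inter_subset_left fun t _ _ => hν' t
    have x2G : ∑ t ∈ (Sb \ Sa) ∩ G, ν' t ≤ ∑ t ∈ Sb \ Sa, ν' t := Finset.sum_le_sum_of_subset_of_nonneg Finset.inter_subset_left fun t _ _ => hν' t
    have y1G : ∑ t ∈ (Tb \ Ta) ∩ G, ν' t ≤ ∑ t ∈ Tb \ Ta, ν' t := Finset.sum_le_sum_of_subset_of_nonneg Finset.inter_subset_left fun t _ _ => hν' t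
    have y2G : ∑ t ∈ (Ta \ Tb) ∩ G, ν' t ≤ ∑ t ∈ Ta \ Tb, ν' t := Finset.sum_le_sum_of_subset_of_nonneg Finset.inter_subset_left fun t _ _ => hν' t
    have Nd1 := need_sdiff_le hsplit hNG0 hND0 hx1 hy1 x1G y1G
    have Nd2 := need_sdiff_le hsplit hNG0 hND0 hx2 hy2 x2G y2G
    have dXa := sum_eq_inter_add_sdiff ν' Sa Sb
    have dXb := sum_eq_inter_add_sdiff ν' Sb Sa
    have dYa := sum_eq_inter_add_sdiff ν' Ta Tb
    have dYb := sum_eq_inter_add_sdiff ν' Tb Ta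
    rw [Finset.inter_comm Sb Sa] at dXb; rw [Finset.inter_comm Tb Ta] at dYb
    have dXGa := sum_inter_eq_inter_add_sdiff ν' Sa Sb G
    have dXGb := sum_inter_eq_inter_add_sdiff ν' Sb Sa G
    have dYGa := sum_inter_eq_inter_add_sdiff ν' Ta Tb G
    have dYGb := sum_inter_eq_inter_add_sdiff ν' Tb Ta G
    rw [Finset.inter_comm Sb Sa] at dXGb; rw [Finset.inter_comm Tb Ta] at dYGb
    have dXu := sum_union_eq_three ν' Sa Sb
    have dYu := sum_union_eq_three ν' Ta Tb
    have dXGu := sum_union_inter_eq_three ν' Sa Sb G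
    have dYGu := sum_union_inter_eq_three ν' Ta Tb G
    simp only [dXa, dXb, dYa, dYb, dXGa, dXGb, dYGa, dYGb, dXu, dXGu, dYu, dYGu] at Hta Htb Hat Hbt Paa Pab Pao Pba Pbb Pbo Poa Pob Pd1 Pd2 Td ⊢
    -- === the certificate: (Z' + ND) * (RHS - LHS) is a nonnegative combination of the facts ===
    rw [← sub_nonneg]
    by_cases hpos : 0 < Z' + ND
    · refine (mul_nonneg_iff_of_pos_left hpos).1 ?_
      have hZN : 0 ≤ Z' + ND := by positivity
      have c1 := mul_le_mul_of_nonneg_left Htt (by positivity : 0 ≤ (Z' + ND) * wtt * (wtt + qb) * (wtt * Z' + qb * ND))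
      have c2 := mul_le_mul_of_nonneg_left Hta (by positivity : 0 ≤ (Z' + ND) * wtt * (wtt + qb) * Z' * wtf)
      have c3 := mul_le_mul_of_nonneg_left Htb (by positivity : 0 ≤ (Z' + ND) * wtt * (wtt + qb) * Z' * wft)
      have c4 := mul_le_mul_of_nonneg_left Hto (by positivity : 0 ≤ (Z' + ND) * wtt * (wtt + qb) * Z' * wff)
      have c5 := mul_le_mul_of_nonneg_left Hat (by positivity : 0 ≤ (Z' + ND) * wtt * (wtt + qb) * Z' * wtf)
      have c6 := mul_le_mul_of_nonneg_left Hbt (by positivity : 0 ≤ (Z' + ND) * wtt * (wtt + qb) * Z' * wft)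
      have c7 := mul_le_mul_of_nonneg_left Hot (by positivity : 0 ≤ (Z' + ND) * wtt * (wtt + qb) * Z' * wff)
      have c8 := mul_le_mul_of_nonneg_left Ma (by positivity : 0 ≤ (Z' + ND) * wtt * (wtt + qb) * Z' ^ 2 * wtf)
      have c9 := mul_le_mul_of_nonneg_left Mb (by positivity : 0 ≤ (Z' + ND) * wtt * (wtt + qb) * Z' ^ 2 * wft)
      have c10 := mul_le_mul_of_nonneg_left Mo (by positivity : 0 ≤ (Z' + ND) * wtt * (wtt + qb) * Z' ^ 2 * wff)
      have c11 := mul_le_mul_of_nonneg_left PkC (by positivity : 0 ≤ (wtt + qb) * Z')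
      have c12 := mul_le_mul_of_nonneg_left PkD (by positivity : 0 ≤ (wtt + qb) * ND)
      have c13 := mul_le_mul_of_nonneg_left Paa (by positivity : 0 ≤ (wtt + qb) * (Z' + ND) * wtf * wtf)
      have c14 := mul_le_mul_of_nonneg_left Pab (by positivity : 0 ≤ (wtt + qb) * Z' * wtf * wft)
      have c15 := mul_le_mul_of_nonneg_left Pao (by positivity : 0 ≤ (wtt + qb) * (Z' + ND) * wtf * wff)
      have c16 := mul_le_mul_of_nonneg_left Pba (by positivity : 0 ≤ (wtt + qb) * Z' * wft * wtf)
      have c17 := mul_le_mul_of_nonneg_left Pbb (by positivity : 0 ≤ (wtt + qb) * (Z' + ND) * wft * wft)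
      have c18 := mul_le_mul_of_nonneg_left Pbo (by positivity : 0 ≤ (wtt + qb) * (Z' + ND) * wft * wff)
      have c19 := mul_le_mul_of_nonneg_left Poa (by positivity : 0 ≤ (wtt + qb) * (Z' + ND) * wff * wtf)
      have c20 := mul_le_mul_of_nonneg_left Pob (by positivity : 0 ≤ (wtt + qb) * (Z' + ND) * wff * wft)
      have c21 := mul_le_mul_of_nonneg_left Poo (by positivity : 0 ≤ (wtt + qb) * (Z' + ND) * wff * wff)
      have c22 := mul_le_mul_of_nonneg_left Pd1 (by positivity : 0 ≤ (wtt + qb) * ND * wtf * wft)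
      have c23 := mul_le_mul_of_nonneg_left Pd2 (by positivity : 0 ≤ (wtt + qb) * ND * wtf * wft)
      have c24 := mul_le_mul_of_nonneg_left Cx1 (by positivity : 0 ≤ (wtt + qb) * Z' * wtf * wft)
      have c25 := mul_le_mul_of_nonneg_left Cx2 (by positivity : 0 ≤ (wtt + qb) * Z' * wtf * wft)
      have c26 := mul_le_mul_of_nonneg_left Td (by positivity : 0 ≤ (Z' + ND) * wtt * ND)
      have c27 := mul_le_mul_of_nonneg_left Nd1 (by positivity : 0 ≤ (wtt + qb) * ND * wtf * wft)
      have c28 := mul_le_mul_of_nonneg_left Nd2 (by positivity : 0 ≤ (wtt + qb) * ND * wtf * wft)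
      have hcx : 0 ≤ ∑ t ∈ ((Sa \ Sb) ∩ (Tb \ Ta)) ∩ G, ν' t + ∑ t ∈ ((Sb \ Sa) ∩ (Ta \ Tb)) ∩ G, ν' t := add_nonneg (Finset.sum_nonneg fun t _ => hν' t) (Finset.sum_nonneg fun t _ => hν' t)
      have hxy : 0 ≤ (∑ t ∈ Sa \ Sb, ν' t) * (∑ t ∈ Tb \ Ta, ν' t) + (∑ t ∈ Sb \ Sa, ν' t) * (∑ t ∈ Ta \ Tb, ν' t) := add_nonneg (mul_nonneg hx1 hy1) (mul_nonneg hx2 hy2)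
      have c29 := mul_le_mul_of_nonneg_left hpa (mul_nonneg (by positivity : 0 ≤ (Z' + ND) * (wtt + qb) * Z' ^ 2) hcx)
      have c30 := mul_le_mul_of_nonneg_left hpa (mul_nonneg (by positivity : 0 ≤ (Z' + ND) * ND * qb) hxy)
      have hqb' : wff + wtf + wft = qb := by rw [hqb]; ring
      rw [hqb'] at c11 c12 c26
      subst hWq
      subst hqb
      subst hsplit
      linarith [c1, c2, c3, c4, c5, c6, c7, c8, c9, c10, c11, c12, c13, c14, c15, c16, c17, c18, c19, c20, c21, c22, c23,
        c24, c25, c26, c27, c28, c29, c30]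
    · -- degenerate case `Z' = 0`: every `ν'`-mass vanishes and the retained mass is nonnegative
      have hZ0 : Z' = 0 := by linarith
      have hz : ∀ X : Finset Q, ∑ t ∈ X, ν' t = 0 := by
        intro X
        refine le_antisymm ?_ (Finset.sum_nonneg fun t _ => hν' t)
        calc ∑ t ∈ X, ν' t ≤ ∑ t, ν' t := Finset.sum_le_univ_sum_of_nonneg hν'
          _ = 0 := by rw [hZ', hZ0]
      have r1 : 0 ≤ ∑ t ∈ (Sa ∩ Ta) ∩ G, R' t := Finset.sum_nonneg fun t ht => hR'0 t (Finset.mem_inter.1 ht).2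
      have r2 : 0 ≤ ∑ t ∈ (Sb ∩ Tb) ∩ G, R' t := Finset.sum_nonneg fun t ht => hR'0 t (Finset.mem_inter.1 ht).2
      have r3 : 0 ≤ ∑ t ∈ (So ∩ To) ∩ G, R' t := Finset.sum_nonneg fun t ht => hR'0 t (Finset.mem_inter.1 ht).2
      simp only [hz, hZ0, mul_zero, zero_mul, add_zero, zero_add, sub_zero]
      have := mul_nonneg (mul_nonneg (mul_nonneg hW0 h0tf) hqb0) r1
      have := mul_nonneg (mul_nonneg (mul_nonneg hW0 h0ft) hqb0) r2
      have := mul_nonneg (mul_nonneg (mul_nonneg hW0 h0ff) hqb0) r3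
      linarith

end Summit.CriticalPhenomena.PercolationContinuityZ3.Theorems.SahiE3DimerOrStep
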